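import Mathlib
import Summits.Ventures.FusionMHD.Models.SAlphaSecondStableS1A28Core0
import HarnessLib

/-!
# STABLE-POINT core at `(1, 14/5)`, piece 6 (`[5/2, 3]`): kernel-decided Taylor-model leaves ⇒ `F_6 > 0` and `amplitudeResidual 1 (14/5) F_6 F_6″ ≤ 0` on the piece ⇒ `EnergyDominatesOn` for its amplitude phase

LADDER-GRIDFUSION rung F3 («F3.BALLOON-sα-S1-SECOND-EDGE-BRACKET»: the first certified point on the SECOND-STABILITY side of the s–α model at Freidberg's own shear s = 1 (DIRECTOR RULING 67 (5) class / I4107 (2); second-edge bracket at s = 1)); gridfusion-model-7 g10, 2026-08-28 (g8/g9 core lane).  Two `decide +kernel` calls (`OpModel.trig.pLeavesCheck`, scale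
`2^60`, Taylor degree 10, 8 leaves of half-width 1/32) and the lane's soundness theorem `OpSem.trig.pos_of_pLeavesCheck`
(Literature/Analysis/ValidatedNumerics/TaylorModelZeroCert); lit-4's `energyDominatesOn_of_amplitude` (BallooningSAlphaStableSide) turns the two
sign facts into energy domination by `amplitudePhase 1 (14/5) F_6 F_6′` on the piece.  MODELLED: `s–α` model; nothing about a device.
No `native_decide`.  Citations: Freidberg 2014 §12.6.2 (12.97) [Freidberg2014]; Makino–Berz 2003 Alg. 2 [MakinoBerz2003]; Hartman 2002 XI.6.2
[Hartman2002].  Everything here is [instance data].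
-/

open Literature.Analysis.ValidatedNumerics Literature.Analysis.ValidatedNumerics.PolyMP
open Literature.Analysis.ValidatedNumerics.NumericsMP Literature.Analysis.ValidatedNumerics.ExpPoly
open Literature.MathematicalPhysics.MHD.Ballooning
open Real Set

namespace Summit.Ventures.FusionMHD.Models

namespace SAlphaSecondStableS1A28

/-- KERNEL CHECK (residual leaves of piece 6). [instance data] -/
theorem ss128_res6_ok : OpModel.trig.pLeavesCheck ss128Prm (2 ^ 60) (ss128Prog Y6 (Poly.deriv (Poly.deriv Y6))) [] ss128Leaves6 = true := by
  decide +kernel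

/-- KERNEL CHECK (positivity leaves of piece 6). [instance data] -/
theorem ss128_pos6_ok : OpModel.trig.pLeavesCheck ss128Prm (2 ^ 60) (ss128PosProg Y6) [] ss128Leaves6 = true := by
  decide +kernel

/-- The leaves tile `[5/2, 3]`. [instance data] -/
theorem ss128_tiles6 : tiles (5/2 : ℚ) (ss128Leaves6.map fun l => (l.e, l.k)) (3 : ℚ) = true := by
  decide +kernel

/-- **PIECE 6**: the phase of `F_6` dominates the `s–α` energy on `[5/2, 3]` at `(s, α) = (1, 14/5)`. [instance data] -/
theorem ss128_dominates6 :
    SAlpha.EnergyDominatesOn 1 (14 / 5) (SAlpha.amplitudePhase 1 (14 / 5) (Poly.eval Y6) (Poly.eval (Poly.deriv Y6)))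
      (Icc (5/2 : ℝ) (3 : ℝ)) := by
  have h := ss128_dominates (lf := Y6) (x := 5/2) (y := 3) (by norm_num) ss128_tiles6 ss128_res6_ok ss128_pos6_ok
  norm_num at h
  exact h

end SAlphaSecondStableS1A28

end Summit.Ventures.FusionMHD.Models
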